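import Literature.NumberTheory.EllipticCurves.FormalMulTwoSecondCoeffProofs
import Literature.RingTheory.PowerSeries.WeierstrassRootIntegrality
import HarnessLib

/-!
# `[2](z) = 2z − a₁z² − 2a₂z³ + (a₁a₂ − 7a₃)z⁴ + ⋯` over every commutative ring (proofs only)

Topic `NumberTheory/EllipticCurves` (theorems only; no definition, no named fact). Continues
`FormalMulTwoSecondCoeffProofs` (`[z²][2] = −a₁`) to the next two coefficients of Silverman,
*AEC* IV.2.3:

* `coeff_two_formalInvDiff = a₁² + a₂`, `coeff_three_formalInvDiff = a₁³ + 2a₁a₂ + 2a₃`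
  (`ω = 1 + a₁z + (a₁² + a₂)z² + (a₁³ + 2a₁a₂ + 2a₃)z³ + ⋯`, Silverman IV.1, from
  `η = 1 − a₁z − a₂z² − 2a₃z³ + O(z⁴)` and `ηω = 1`);
* `coeff_three_formalMul_two = −2a₂`, `coeff_four_formalMul_two = a₁a₂ − 7a₃` — the invariance
  `ω([2]z)·[2]'(z) = 2ω(z)` (`formalInvDiff_subst_formalMul_mul_derivative'`, any ring) read in
  degrees `2` and `3` (`3c₃ + 6a₁c₂ + 8ω₂ = 2ω₂`, `4c₄ + 6a₁c₃ + 2c₂(a₁c₂ + 4ω₂) + 2(a₁c₃ + 4ω₂c₂ +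
  8ω₃) = 2ω₃`), over `ℤ[a₁,…,a₆]` and by specialisation.

Use (finite-height route to Edixhoven's integrality at `p = 2`, `NeronIsogenyScaling.lean`): on a
supersingular good model at `2` (`a₁'' ∈ 𝔪`, `a₃'' ∈ O^×`) the coefficient `b₄ = a₁''a₂'' − 7a₃''` of
`[2]` is a unit, giving the slope hypothesis of `ManinConstantSemistableTwistWildProofs` with `i = 4`
(`ν < 4/3`); with `b₂ = −a₁''` (`i = 2`) this covers every semistable model at `2`.

## References

* J. H. Silverman, *The Arithmetic of Elliptic Curves*, 2nd ed. (2009), IV.1 (expansion of `ω`),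
  IV.2.3 (`[2](z) = 2z − a₁z² − 2a₂z³ + (a₁a₂ − 7a₃)z⁴ + ⋯`). [SilvermanAEC2009]
-/

noncomputable section

open PowerSeries Literature.NumberTheory.EllipticCurves Finset

namespace WeierstrassCurve

variable {R : Type*} [CommRing R] (W : WeierstrassCurve R)

/-! ### `η` and `ω = 1/η` to order `3` -/

/-- `η = 1 − a₁z − z²·(a₂ + 2a₃zB + 2a₄z²B + 3a₆z⁴B²)` with `w = z³B`, `B(0) = 1`. [folklore] -/
theorem formalEta_eq_low (B : R⟦X⟧) (hB : W.formalW = X ^ 3 * B) :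
    W.formalEta = 1 - C W.a₁ * X - X ^ 2 *
      (C W.a₂ + 2 * C W.a₃ * X * B + 2 * C W.a₄ * X ^ 2 * B + 3 * C W.a₆ * X ^ 4 * B ^ 2) := by
  rw [formalEta_def, hB]; ring

/-- `w = z³·B` with `B(0) = 1`. [cite: SilvermanAEC2009, IV.1.1] -/
theorem exists_formalW_eq_X_pow_three_mul :
    ∃ B : R⟦X⟧, W.formalW = X ^ 3 * B ∧ constantCoeff B = 1 := by
  obtain ⟨B, hB⟩ : (X : R⟦X⟧) ^ 3 ∣ W.formalW :=
    X_pow_dvd_iff.mpr fun m hm ↦ W.coeff_formalW_of_lt_three hm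
  refine ⟨B, hB, ?_⟩
  have h := W.coeff_three_formalW
  rw [hB, coeff_X_pow_mul', if_pos le_rfl, Nat.sub_self, coeff_zero_eq_constantCoeff_apply] at h
  exact h

/-- `[z²] η = −a₂`. [cite: SilvermanAEC2009, IV.1.1] -/
theorem coeff_two_formalEta : coeff 2 W.formalEta = -W.a₂ := by
  obtain ⟨B, hB, hB0⟩ := W.exists_formalW_eq_X_pow_three_mul
  rw [W.formalEta_eq_low B hB, map_sub, map_sub, coeff_one, if_neg (by norm_num), coeff_C_mul,
    coeff_X, if_neg (by norm_num), mul_zero, sub_zero, coeff_X_pow_mul', if_pos le_rfl, Nat.sub_self,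
    coeff_zero_eq_constantCoeff]
  simp [hB0]

/-- `[z³] η = −2a₃`. [cite: SilvermanAEC2009, IV.1.1] -/
theorem coeff_three_formalEta : coeff 3 W.formalEta = -2 * W.a₃ := by
  obtain ⟨B, hB, hB0⟩ := W.exists_formalW_eq_X_pow_three_mul
  rw [W.formalEta_eq_low B hB, map_sub, map_sub, coeff_one, if_neg (by norm_num), coeff_C_mul,
    coeff_X, if_neg (by norm_num), mul_zero, sub_zero, coeff_X_pow_mul', if_pos (by norm_num),
    show 3 - 2 = 1 from rfl]
  have h2 : (2 : R⟦X⟧) = C (2 : R) := by rw [map_ofNat]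
  have h3 : (3 : R⟦X⟧) = C (3 : R) := by rw [map_ofNat]
  simp only [map_add, map_mul, PowerSeries.coeff_one_mul, coeff_one_X, constantCoeff_C, constantCoeff_X,
    h2, h3, coeff_C, if_neg one_ne_zero, hB0, mul_zero, zero_mul, add_zero, mul_one, zero_add,
    map_pow]
  simp

/-- `[z²] ω = a₁² + a₂`. [cite: SilvermanAEC2009, IV.1.1] -/
theorem coeff_two_formalInvDiff : coeff 2 W.formalInvDiff = W.a₁ ^ 2 + W.a₂ := by
  have h := congrArg (coeff 2) W.formalEta_mul_formalInvDiff
  rw [coeff_mul, Nat.sum_antidiagonal_eq_sum_range_succ (fun i j ↦ coeff i W.formalEta * coeff j W.formalInvDiff),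
    coeff_one, if_neg (by norm_num)] at h
  simp only [sum_range_succ, sum_range_zero, zero_add, Nat.sub_zero, show 2 - 1 = 1 from rfl,
    Nat.sub_self, coeff_zero_eq_constantCoeff, W.constantCoeff_formalEta, W.constantCoeff_formalInvDiff,
    W.coeff_one_formalInvDiff, coeff_two_formalEta] at h
  have h1 : coeff 1 W.formalEta = -W.a₁ := by
    have := congrArg (coeff 1) W.formalEta_mul_formalInvDiff
    rw [PowerSeries.coeff_one_mul, W.constantCoeff_formalEta, W.constantCoeff_formalInvDiff,
      W.coeff_one_formalInvDiff, coeff_one, if_neg one_ne_zero] at this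
    linear_combination this
  rw [h1] at h
  linear_combination h

/-- `[z³] ω = a₁³ + 2a₁a₂ + 2a₃`. [cite: SilvermanAEC2009, IV.1.1] -/
theorem coeff_three_formalInvDiff :
    coeff 3 W.formalInvDiff = W.a₁ ^ 3 + 2 * W.a₁ * W.a₂ + 2 * W.a₃ := by
  have h := congrArg (coeff 3) W.formalEta_mul_formalInvDiff
  rw [coeff_mul, Nat.sum_antidiagonal_eq_sum_range_succ (fun i j ↦ coeff i W.formalEta * coeff j W.formalInvDiff),
    coeff_one, if_neg (by norm_num)] at h
  have h1 : coeff 1 W.formalEta = -W.a₁ := by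
    have := congrArg (coeff 1) W.formalEta_mul_formalInvDiff
    rw [PowerSeries.coeff_one_mul, W.constantCoeff_formalEta, W.constantCoeff_formalInvDiff,
      W.coeff_one_formalInvDiff, coeff_one, if_neg one_ne_zero] at this
    linear_combination this
  simp only [sum_range_succ, sum_range_zero, zero_add, Nat.sub_zero, show 3 - 1 = 2 from rfl,
    show 3 - 2 = 1 from rfl, Nat.sub_self, coeff_zero_eq_constantCoeff, W.constantCoeff_formalEta,
    W.constantCoeff_formalInvDiff, W.coeff_one_formalInvDiff, coeff_two_formalEta, coeff_three_formalEta,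
    coeff_two_formalInvDiff, h1] at h
  linear_combination h

/-! ### Coefficients of a substitution and of small powers -/

/-- `[zⁿ] f(g) = Σ_{j ≤ n} f_j [zⁿ] gʲ` for `g(0) = 0`, over any commutative ring. [folklore] -/
theorem coeff_subst_eq_sum_range' (f : R⟦X⟧) {g : R⟦X⟧} (hg : constantCoeff g = 0) (n : ℕ) :
    coeff n (f.subst g) = ∑ j ∈ range (n + 1), coeff j f * coeff n (g ^ j) := by
  have h := Literature.RingTheory.PowerSeries.X_pow_dvd_subst_sub_sum (O := R) (L := R) hg f (n + 1)
  have h0 := (X_pow_dvd_iff.mp h) n (Nat.lt_succ_self n)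
  rw [map_sub, sub_eq_zero, map_sum] at h0
  rw [h0]
  refine sum_congr rfl fun j _ ↦ ?_
  rw [coeff_C_mul]
  rfl

variable {g : R⟦X⟧} (hg : constantCoeff g = 0)
include hg

/-- `[z¹] g² = 0`, `[z²] g² = g₁²`, `[z³] g² = 2g₁g₂` for `g(0) = 0`. [folklore] -/
theorem coeff_sq_low :
    coeff 1 (g ^ 2) = 0 ∧ coeff 2 (g ^ 2) = coeff 1 g ^ 2 ∧ coeff 3 (g ^ 2) = 2 * coeff 1 g * coeff 2 g := by
  have h0 : coeff 0 g = 0 := by rw [coeff_zero_eq_constantCoeff]; exact hg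
  refine ⟨?_, ?_, ?_⟩
  · rw [sq, coeff_mul, Nat.sum_antidiagonal_eq_sum_range_succ (fun i j ↦ coeff i g * coeff j g)]
    simp [sum_range_succ, h0]
  · rw [sq, coeff_mul, Nat.sum_antidiagonal_eq_sum_range_succ (fun i j ↦ coeff i g * coeff j g)]
    simp [sum_range_succ, h0]; ring
  · rw [sq, coeff_mul, Nat.sum_antidiagonal_eq_sum_range_succ (fun i j ↦ coeff i g * coeff j g)]
    simp [sum_range_succ, h0]; ring

/-- `[z³] g³ = g₁³` (and the lower coefficients vanish) for `g(0) = 0`. [folklore] -/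
theorem coeff_three_pow_three : coeff 3 (g ^ 3) = coeff 1 g ^ 3 := by
  obtain ⟨h1, h2, -⟩ := coeff_sq_low hg
  have h0 : coeff 0 g = 0 := by rw [coeff_zero_eq_constantCoeff]; exact hg
  have h00 : coeff 0 (g ^ 2) = 0 := by
    rw [coeff_zero_eq_constantCoeff, map_pow, hg, zero_pow two_ne_zero]
  rw [pow_succ, coeff_mul, Nat.sum_antidiagonal_eq_sum_range_succ (fun i j ↦ coeff i (g ^ 2) * coeff j g)]
  simp [sum_range_succ, h0, h00, h1, h2]; ring

omit hg

/-! ### `[2]` to order `4` -/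

/-- **`[z³][2] = −2a₂` and `[z⁴][2] = a₁a₂ − 7a₃` over every commutative ring** (Silverman IV.2.3),
from `ω([2]z)·[2]'(z) = 2ω(z)` in degrees `2, 3` over `ℤ[a₁,…,a₆]`, then specialised.
[cite: SilvermanAEC2009, IV.2.3] -/
theorem coeff_three_four_formalMul_two :
    coeff 3 (W.formalMul 2) = -2 * W.a₂ ∧ coeff 4 (W.formalMul 2) = W.a₁ * W.a₂ - 7 * W.a₃ := by
  -- the universal case
  have hZ : coeff 3 (universalInt.formalMul 2) = -2 * universalInt.a₂ ∧
      coeff 4 (universalInt.formalMul 2) = universalInt.a₁ * universalInt.a₂ - 7 * universalInt.a₃ := by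
    set U := universalInt with hU
    have key := U.formalInvDiff_subst_formalMul_mul_derivative' 2
    set D := U.formalMul 2 with hDdef
    set ι := U.formalInvDiff with hιdef
    have hD0 : constantCoeff D = 0 := U.constantCoeff_formalMul 2
    have hD0' : coeff 0 D = 0 := by rw [coeff_zero_eq_constantCoeff]; exact hD0
    have hD1 : coeff 1 D = 2 := by rw [hDdef, U.coeff_one_formalMul']; norm_num
    have hD2 : coeff 2 D = -U.a₁ := U.coeff_two_formalMul_two
    obtain ⟨hsq1, hsq2, hsq3⟩ := coeff_sq_low hD0
    have hcube := coeff_three_pow_three hD0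
    have hι0 : coeff 0 ι = 1 := by rw [coeff_zero_eq_constantCoeff]; exact U.constantCoeff_formalInvDiff
    have hι1 : coeff 1 ι = U.a₁ := U.coeff_one_formalInvDiff
    have hι2 : coeff 2 ι = U.a₁ ^ 2 + U.a₂ := U.coeff_two_formalInvDiff
    have hι3 : coeff 3 ι = U.a₁ ^ 3 + 2 * U.a₁ * U.a₂ + 2 * U.a₃ := U.coeff_three_formalInvDiff
    -- `A = ι(D)`: coefficients 0..3
    set A := ι.subst D with hA
    have hA0 : coeff 0 A = 1 := by
      rw [coeff_zero_eq_constantCoeff, hA, constantCoeff_subst_eq_constantCoeff hD0]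
      exact U.constantCoeff_formalInvDiff
    have hA1 : coeff 1 A = U.a₁ * 2 := by rw [hA, coeff_one_subst_eq_mul _ hD0, hι1, hD1]
    have hA2 : coeff 2 A = U.a₁ * coeff 2 D + (U.a₁ ^ 2 + U.a₂) * 4 := by
      rw [hA, coeff_subst_eq_sum_range' _ hD0 2]
      simp only [sum_range_succ, sum_range_zero, zero_add, pow_zero, coeff_one, pow_one, hι1, hι2, hsq2, hD1]
      norm_num
    have hA3 : coeff 3 A = U.a₁ * coeff 3 D + (U.a₁ ^ 2 + U.a₂) * (2 * 2 * coeff 2 D) +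
        (U.a₁ ^ 3 + 2 * U.a₁ * U.a₂ + 2 * U.a₃) * 8 := by
      rw [hA, coeff_subst_eq_sum_range' _ hD0 3]
      simp only [sum_range_succ, sum_range_zero, zero_add, pow_zero, coeff_one, pow_one, hι1, hι2, hι3,
        hsq3, hcube, hD1]
      norm_num
    -- `B = D'`: coefficients 0..3
    set B := d⁄dX (MvPolynomial (Fin 5) ℤ) D with hB
    have hB0 : coeff 0 B = 2 := by rw [hB, PowerSeries.coeff_derivative, zero_add, hD1]; simp
    have hB1 : coeff 1 B = coeff 2 D * 2 := by rw [hB, PowerSeries.coeff_derivative]; norm_num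
    have hB2 : coeff 2 B = coeff 3 D * 3 := by rw [hB, PowerSeries.coeff_derivative]; norm_num
    have hB3 : coeff 3 B = coeff 4 D * 4 := by rw [hB, PowerSeries.coeff_derivative]; norm_num
    -- degree 2 and 3 of `A * B = 2 • ι`
    have e2 := congrArg (coeff 2) key
    have e3 := congrArg (coeff 3) key
    rw [coeff_mul, Nat.sum_antidiagonal_eq_sum_range_succ (fun i j ↦ coeff i A * coeff j B), map_nsmul] at e2 e3
    simp only [sum_range_succ, sum_range_zero, zero_add, Nat.sub_zero, show 2 - 1 = 1 from rfl, Nat.sub_self,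
      show 3 - 1 = 2 from rfl, hA0, hA1, hA2, hA3, hB0, hB1, hB2, hB3, hι2, hι3,
      hD2, nsmul_eq_mul, Nat.cast_ofNat] at e2 e3
    -- solve: `3 c₃ = -6 a₂`, then `4 c₄ = 4(a₁a₂ − 7a₃)`
    have h3ne : (3 : MvPolynomial (Fin 5) ℤ) ≠ 0 := by exact_mod_cast (by norm_num : (3 : ℤ) ≠ 0)
    have h4ne : (4 : MvPolynomial (Fin 5) ℤ) ≠ 0 := by exact_mod_cast (by norm_num : (4 : ℤ) ≠ 0)
    have hc3 : coeff 3 D = -2 * U.a₂ := by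
      have h' : (3 : MvPolynomial (Fin 5) ℤ) * (coeff 3 D + 2 * U.a₂) = 0 := by linear_combination e2
      have := (mul_eq_zero.mp h').resolve_left h3ne
      linear_combination this
    rw [hc3] at e3
    have hc4 : coeff 4 D = U.a₁ * U.a₂ - 7 * U.a₃ := by
      have h' : (4 : MvPolynomial (Fin 5) ℤ) * (coeff 4 D - (U.a₁ * U.a₂ - 7 * U.a₃)) = 0 := by
        linear_combination e3
      have := (mul_eq_zero.mp h').resolve_left h4ne
      linear_combination this
    exact ⟨hc3, hc4⟩
  -- specialise
  have ha := W.universalInt_map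
  have ha₁ : W.universalEval universalInt.a₁ = W.a₁ := by
    have := congrArg WeierstrassCurve.a₁ ha; rwa [map_a₁] at this
  have ha₂ : W.universalEval universalInt.a₂ = W.a₂ := by
    have := congrArg WeierstrassCurve.a₂ ha; rwa [map_a₂] at this
  have ha₃ : W.universalEval universalInt.a₃ = W.a₃ := by
    have := congrArg WeierstrassCurve.a₃ ha; rwa [map_a₃] at this
  obtain ⟨h3, h4⟩ := hZ
  have hR3 := congrArg W.universalEval h3
  have hR4 := congrArg W.universalEval h4
  rw [← coeff_map, map_formalMul, universalInt_map] at hR3 hR4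
  refine ⟨?_, ?_⟩
  · rw [hR3, map_mul, map_neg, map_ofNat, ha₂]
  · rw [hR4, map_sub, map_mul, map_mul, map_ofNat, ha₁, ha₂, ha₃]

/-- `[z³][2] = −2a₂`. [cite: SilvermanAEC2009, IV.2.3] -/
theorem coeff_three_formalMul_two : coeff 3 (W.formalMul 2) = -2 * W.a₂ :=
  W.coeff_three_four_formalMul_two.1

/-- **`[z⁴][2] = a₁a₂ − 7a₃`** — the coefficient that is a UNIT on a supersingular good model at `2`
(`a₁ ∈ 𝔪`, `a₃ ∈ O^×`): height exactly `2`. [cite: SilvermanAEC2009, IV.2.3] -/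
theorem coeff_four_formalMul_two : coeff 4 (W.formalMul 2) = W.a₁ * W.a₂ - 7 * W.a₃ :=
  W.coeff_three_four_formalMul_two.2

end WeierstrassCurve
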